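import Summits.QuantumFields.YangMills.Theorems.BalabanUVNodesN21ChartExponentConvexityLocal

/-!
# N21 (NE7c) · CONVEXITY OF THE (1.2) EXPONENT IS LOCAL, II: the diameter-free ★★ ∕ ★★′ on pub-balaban's
# `BlockChartSU N b` + the A2 witness separating the local theorem from the global one (file 5 of WIDTH-209 N21 piece 2)

Width seat pub-ymgap-dag-n21-w3 (g4), node N21 = NE7c (NOT PRINTED, NOT proved), lane K3⁷ `SpineGivenEndpointR13SepCoPH`
(stmt-QuantumFields-20544, `--kind proof --supports … --as helper`).  Companion of `…N21ChartExponentConvexityLocal`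
(file 4: segment criterion, Cauchy `n = 2`, CORE, flat frame), split off for the 400-line rule.

WHAT (THEOREMS ONLY; 0 `def`, 0 `sorry`).
* §4 the block chart space `BlockChartSU N b = ↥b → E_N` of dag-n21-w1 g2's ★★★ (p604008) and dag-n21-w2's JUNCTION №3
  (`J = ι ∘ flat`, `N₂ v = Σ_{b′} ‖v b′‖²`, through g3's `norm_flat_le` ∕ `sq_norm_le_sum_sq_norm` BY NAME):
  `convexOn_blockChartSU_expansion_of_analyticBound_local` and its readings ★★-loc
  `convexOn_blockChartSU_expansion_of_analyticRemainder_local` = p607734 ★★ MINUS `hdiam` (PLUS `0 < r`; clause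
  `4·d·(100M)^{d+1}·B ≤ γ₀·r²`) and ★★′-loc `convexOn_blockChartSU_expansion_of_analyticSupBound_local` = p607734 ★★′
  MINUS `hdiam` (clause `4·d·(100M)^{d+1}·S ≤ γ₀·r²`) — the form dag-n21-w1 g2's file 15 ★ `cutChartLawAC_of_sect1Letters_analytic`,
  dag-n21-w4 g2's `…RecordAnalytic` and dag-n21-w5 g2's U(1) ★★★ consume: their `hdiam` binder drops BY NAME (and their
  convexity clause weakens ×4).
* §5 [textbook] A2 WITNESS (director-ym STANDING RULE №189 (3)): block `ℝ¹`, `K = [−1, 1]`, `φ = ½w₀² + w₀³∕16`,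
  `Φ = u₀³∕16`, `r = 1`, `S = ½`, (1.9) at `γ₀ = 2`, `d = 1`, `M = 1∕100`: `convexOn_witness_local` — ★★′-loc FIRES (every
  binder discharged in the kernel, clause with equality); `diamClause_void_on_witness` — on the same instance g3's ★★′ is
  VOID AT EVERY RADIUS (`hdiam` forces `r > 2`, the value row forces `S ≥ r³∕16`, and then `16·S ≤ 2r²` fails).  So the
  diameter binder restricted the DEVICE, not the conclusion.
LOCATED REMARK (print first-hand, `lit read` [B13] = CMP 116 p. 9 ∕ p. 11, [LF-II] = CMP 122 pp. 356–357): in print's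
own regime the diameter binder is HARMLESS — [B13] Lemma 2 gives the fluctuation-field action analytic on the space
(1.34) `{B : |B| < ε₁g_k⁻¹ on Y}` (a complex POLYDISC of fixed radius `ε₁g_k⁻¹`, value bound (1.36) there), while the
real chart of [LF-II] (1.2) is `χ({|B′| < M₀g_k⁻¹ε_k})` with `ε_k → 0`, so sup-norm `r`-balls with
`r = (ε₁ − M₀ε_k)g_k⁻¹ > 2M₀ε_kg_k⁻¹ = diam K` fit; and the (1.2) remainder `V` of the denominator's Wilson term is even
ENTIRE in `B′` (`V = exp(ig_kB′)` through a polynomial action).  What the local edition buys is hygiene and robustness: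
one displayed geometric binder fewer in every consumer, a clause better by ×2 ∕ ×4, and the shape a consumer needs when a
kept cut is NOT small against the analyticity width (later-step remainders analytic only on (1.34)-type spaces about a
large real region).  Nothing here identifies the tree's letters with print's objects.

HONEST FRAMING.  [folklore] coordinates + [textbook] convex analysis over file 4 ∕ g3's files BY NAME; located letters NOT
asserted; nothing of Bałaban's asserted; (M1) ∕ NE7c NOT PRINTED ∕ NOT proved; N21 NOT discharged; K3⁷ NOT claimed; counts
unmoved (typed 28∕28 · discharged 5∕27); count-neutral; one finite 𝕋⁴ at fixed ε — the Yang–Mills mass gap (Clay) is NOT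
proved by any of this: R4 closes the conditional finite-𝕋⁴ rung `BalabanLadder.UV` only; nothing continuum ∕ ℝ⁴ ∕ OS.
-/

set_option autoImplicit false

noncomputable section

open Set Function Filter Metric Topology
open scoped ENNReal

namespace Summit.QuantumFields.YangMills.Theorems.N21ChartExponentConvexityLocalSUN

open Summit.QuantumFields.YangMills.Theorems.N21ChartExponentConvexityLocal

/-! ## §4  pub-balaban's block chart space `BlockChartSU N b`: g3's ★★ ∕ ★★′ (p607734) WITHOUT `hdiam` -/

section BlockChart

open Matrix
open Literature.MathematicalPhysics.QuantumFieldTheory.Balaban1983to89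
open Literature.MathematicalPhysics.QuantumFieldTheory.Balaban1983to89.B16Sect1Wilson (Ineq19)
open Summit.QuantumFields.BalabanUV.T4Continuum.ShellMeasureExpChartSUN (BlockChartSU dimSU)
open Summit.QuantumFields.YangMills.Theorems.N21AnalyticResponseRemainder (norm_realToComplex_pi)
open Summit.QuantumFields.YangMills.Theorems.N21ChartExponentConvexitySUN
  (flat_add flat_smul norm_flat_le sq_norm_le_sum_sq_norm)

variable {N : ℕ} {P : Params} {j : ℕ}

/-- **LOCAL FORM on `BlockChartSU N b`, value bound about a centre.**  §3's first theorem in the flat complex coordinates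
`↥b × Fin d_N → ℂ` of the block chart space: `Qf v = flat v ⬝ᵥ (A *ᵥ flat v)`, (1.9) against `Σ_{b′} ‖v b′‖²`,
`Vt = Re Φ ∘ ι ∘ flat`, `Φ` complex differentiable with `‖Φ − a_x‖ ≤ B` on the `r`-ball about every `ι(flat x)`, `x ∈ K`
⇒ `ConvexOn ℝ K φ` under `0 < r` and `4·d·(100M)^{d+1}·B ≤ γ₀·r²` (§2 at `J = ι ∘ flat`, `‖ι(flat v)‖ ≤ ‖v‖`,
`‖v‖² ≤ Σ_{b′}‖v b′‖²`). [textbook] -/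
theorem convexOn_blockChartSU_expansion_of_analyticBound_local (b : Finset (PBond P j)) {K : Set (BlockChartSU N b)}
    (hK : Convex ℝ K) (φ Qf lin Vt : BlockChartSU N b → ℝ) (c : ℝ)
    (hexp : ∀ v ∈ K, φ v = c + 1 / 2 * Qf v + lin v + Vt v)
    (A : Matrix (↥b × Fin (dimSU N)) (↥b × Fin (dimSU N)) ℝ)
    (hQf : ∀ v, Qf v = (fun q : ↥b × Fin (dimSU N) => v q.1 q.2) ⬝ᵥ (A *ᵥ fun q => v q.1 q.2))
    {γ₀ M : ℝ} {d : ℕ} (hd : 1 ≤ d) (hM : 0 < M)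
    (h19 : ∀ v, Ineq19 (Qf v) (∑ i, ‖v i‖ ^ 2) γ₀ d M)
    (ℓ : BlockChartSU N b →ₗ[ℝ] ℝ) (hlin : ∀ v, lin v = ℓ v)
    (Φ : (↥b × Fin (dimSU N) → ℂ) → ℂ) {r B : ℝ} (hr : 0 < r)
    (hVt : ∀ x ∈ K, Vt x = (Φ fun q => ((x q.1 q.2 : ℝ) : ℂ)).re)
    (hΦd : ∀ x ∈ K, DifferentiableOn ℂ Φ (ball (fun q => ((x q.1 q.2 : ℝ) : ℂ)) r))
    (hΦB : ∀ x ∈ K, ∃ a : ℂ, ∀ u ∈ ball (fun q : ↥b × Fin (dimSU N) => ((x q.1 q.2 : ℝ) : ℂ)) r, ‖Φ u - a‖ ≤ B)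
    (hclause : 4 * d * (100 * M) ^ (d + 1) * B ≤ γ₀ * r ^ 2) :
    ConvexOn ℝ K φ := by
  -- the real-linear flat complexification `ι ∘ flat` of the block chart space
  let J : BlockChartSU N b →ₗ[ℝ] (↥b × Fin (dimSU N) → ℂ) :=
    { toFun := fun x q => ((x q.1 q.2 : ℝ) : ℂ)
      map_add' := fun x y => by ext q; simp
      map_smul' := fun a x => by ext q; simp }
  have hJ : ∀ v, J v = fun q => ((v q.1 q.2 : ℝ) : ℂ) := fun v => rfl
  have hd0 : (0 : ℝ) < d := by exact_mod_cast hd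
  set D : ℝ := 2 * d * (100 * M) ^ (d + 1) with hD
  have hDpos : 0 < D := by positivity
  refine convexOn_of_lineExpansion_of_locallyAnalytic hK φ Qf c ℓ J Φ (fun v hv => ?_)
    (fun x h => (fun q : ↥b × Fin (dimSU N) => x q.1 q.2) ⬝ᵥ (A *ᵥ fun q => h q.1 q.2) +
      (fun q : ↥b × Fin (dimSU N) => h q.1 q.2) ⬝ᵥ (A *ᵥ fun q => x q.1 q.2))
    (fun x h t => ?_) (fun v => ∑ i, ‖v i‖ ^ 2) (lam := γ₀ / D) hr
    (fun v => ?_) (fun v => ?_) (fun x hx => by rw [hJ]; exact hΦd x hx) (fun x hx => by rw [hJ]; exact hΦB x hx) ?_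
  · rw [hexp v hv, hlin v, hVt v hv, hJ]
  · rw [hQf, hQf, hQf, flat_add, flat_smul]
    simp only [mulVec_add, mulVec_smul, dotProduct_add, add_dotProduct, dotProduct_smul, smul_dotProduct, smul_eq_mul]
    ring
  · have := h19 v
    unfold Ineq19 at this
    simpa [hD] using this
  · rw [hJ, norm_realToComplex_pi]
    exact (pow_le_pow_left₀ (norm_nonneg _) (norm_flat_le b v) 2).trans (sq_norm_le_sum_sq_norm b v)
  · rw [div_mul_eq_mul_div, le_div_iff₀ hDpos]
    calc 2 * B * D = 4 * d * (100 * M) ^ (d + 1) * B := by rw [hD]; ring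
      _ ≤ γ₀ * r ^ 2 := hclause

/-- ★★-loc on `BlockChartSU N b`: **g3's ★★ `convexOn_blockChartSU_expansion_of_analyticRemainder` WITHOUT `hdiam`**
(oscillation letter `B`): `ConvexOn ℝ K φ` under `0 < r` and `4·d·(100M)^{d+1}·B ≤ γ₀·r²`. [textbook] -/
theorem convexOn_blockChartSU_expansion_of_analyticRemainder_local (b : Finset (PBond P j))
    {K : Set (BlockChartSU N b)} (hK : Convex ℝ K) (φ Qf lin Vt : BlockChartSU N b → ℝ) (c : ℝ)
    (hexp : ∀ v ∈ K, φ v = c + 1 / 2 * Qf v + lin v + Vt v)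
    (A : Matrix (↥b × Fin (dimSU N)) (↥b × Fin (dimSU N)) ℝ)
    (hQf : ∀ v, Qf v = (fun q : ↥b × Fin (dimSU N) => v q.1 q.2) ⬝ᵥ (A *ᵥ fun q => v q.1 q.2))
    {γ₀ M : ℝ} {d : ℕ} (hd : 1 ≤ d) (hM : 0 < M)
    (h19 : ∀ v, Ineq19 (Qf v) (∑ i, ‖v i‖ ^ 2) γ₀ d M)
    (ℓ : BlockChartSU N b →ₗ[ℝ] ℝ) (hlin : ∀ v, lin v = ℓ v)
    (Φ : (↥b × Fin (dimSU N) → ℂ) → ℂ) {r B : ℝ} (hr : 0 < r)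
    (hVt : ∀ x ∈ K, Vt x = (Φ fun q => ((x q.1 q.2 : ℝ) : ℂ)).re)
    (hΦd : ∀ x ∈ K, DifferentiableOn ℂ Φ (ball (fun q => ((x q.1 q.2 : ℝ) : ℂ)) r))
    (hΦB : ∀ x ∈ K, MapsTo Φ (ball (fun q => ((x q.1 q.2 : ℝ) : ℂ)) r) (closedBall (Φ fun q => ((x q.1 q.2 : ℝ) : ℂ)) B))
    (hclause : 4 * d * (100 * M) ^ (d + 1) * B ≤ γ₀ * r ^ 2) :
    ConvexOn ℝ K φ :=
  convexOn_blockChartSU_expansion_of_analyticBound_local b hK φ Qf lin Vt c hexp A hQf hd hM h19 ℓ hlin Φ hr hVt hΦd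
    (fun x hx => ⟨Φ fun q => ((x q.1 q.2 : ℝ) : ℂ), fun u hu => by
      have := hΦB x hx hu
      rwa [mem_closedBall, dist_eq_norm] at this⟩) hclause

/-- ★★′-loc on `BlockChartSU N b`: **g3's ★★′ `convexOn_blockChartSU_expansion_of_analyticSupBound` WITHOUT `hdiam`**
(value row `‖Φ‖ ≤ S` on the complex `r`-balls — the form dag-n21-w1 g2's file 15 ★ and dag-n21-w4 ∕ -w5 g2 consume):
`ConvexOn ℝ K φ` under `0 < r` and `4·d·(100M)^{d+1}·S ≤ γ₀·r²`. [textbook] -/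
theorem convexOn_blockChartSU_expansion_of_analyticSupBound_local (b : Finset (PBond P j))
    {K : Set (BlockChartSU N b)} (hK : Convex ℝ K) (φ Qf lin Vt : BlockChartSU N b → ℝ) (c : ℝ)
    (hexp : ∀ v ∈ K, φ v = c + 1 / 2 * Qf v + lin v + Vt v)
    (A : Matrix (↥b × Fin (dimSU N)) (↥b × Fin (dimSU N)) ℝ)
    (hQf : ∀ v, Qf v = (fun q : ↥b × Fin (dimSU N) => v q.1 q.2) ⬝ᵥ (A *ᵥ fun q => v q.1 q.2))
    {γ₀ M : ℝ} {d : ℕ} (hd : 1 ≤ d) (hM : 0 < M)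
    (h19 : ∀ v, Ineq19 (Qf v) (∑ i, ‖v i‖ ^ 2) γ₀ d M)
    (ℓ : BlockChartSU N b →ₗ[ℝ] ℝ) (hlin : ∀ v, lin v = ℓ v)
    (Φ : (↥b × Fin (dimSU N) → ℂ) → ℂ) {r S : ℝ} (hr : 0 < r)
    (hVt : ∀ x ∈ K, Vt x = (Φ fun q => ((x q.1 q.2 : ℝ) : ℂ)).re)
    (hΦd : ∀ x ∈ K, DifferentiableOn ℂ Φ (ball (fun q => ((x q.1 q.2 : ℝ) : ℂ)) r))
    (hΦS : ∀ x ∈ K, ∀ u ∈ ball (fun q : ↥b × Fin (dimSU N) => ((x q.1 q.2 : ℝ) : ℂ)) r, ‖Φ u‖ ≤ S)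
    (hclause : 4 * d * (100 * M) ^ (d + 1) * S ≤ γ₀ * r ^ 2) :
    ConvexOn ℝ K φ :=
  convexOn_blockChartSU_expansion_of_analyticBound_local b hK φ Qf lin Vt c hexp A hQf hd hM h19 ℓ hlin Φ hr hVt hΦd
    (fun x hx => ⟨0, fun u hu => by rw [sub_zero]; exact hΦS x hx u hu⟩) hclause

end BlockChart

/-! ## §5  A2: the diameter binder was load-bearing for the DEVICE, not for the CONCLUSION — a witness where `hdiam`
fails (and g3's clause is void at every admissible radius) while ★★′-loc fires -/

section Witness

open Matrix
open Literature.MathematicalPhysics.QuantumFieldTheory.Balaban1983to89.B16Sect1Wilson (Ineq19)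

/-- **WITNESS, positive half** (director-ym STANDING A6∕A2 RULE): block `ℝ¹`, `K = closedBall 0 1 = [−1, 1]`,
`φ w = ½w₀² + w₀³∕16` (`c = 0`, `Qf w = w₀² = w ⬝ᵥ (1 *ᵥ w)`, (1.9) at `γ₀ = 2`, `d = 1`, `M = 1∕100` — with equality,
`lin = 0`, third-order remainder `Vt = Re (u₀³∕16) ∘ ι`), analyticity radius `r = 1` (HALF the diameter of `K`), value
row `S = ½` (`|u₀| < 2` on the `1`-balls about real points of `K`), clause `4·1·1·½ ≤ 2·1²` with equality:
★★′-loc gives `ConvexOn` — indeed `φ″ = 1 + 3w₀∕8 ≥ 5∕8`. [textbook] -/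
theorem convexOn_witness_local :
    ConvexOn ℝ (closedBall (0 : Fin 1 → ℝ) 1)
      (fun w : Fin 1 → ℝ => 1 / 2 * w 0 ^ 2 + (1 / 16 : ℝ) * w 0 ^ 3) := by
  have hdot : ∀ v : Fin 1 → ℝ, v 0 ^ 2 = v ⬝ᵥ ((1 : Matrix (Fin 1) (Fin 1) ℝ) *ᵥ v) := by
    intro v
    rw [one_mulVec, dotProduct, Fin.sum_univ_one, sq]
  refine convexOn_expansion_of_analyticSupBound_local (convex_closedBall _ _)
    (fun w => 1 / 2 * w 0 ^ 2 + (1 / 16 : ℝ) * w 0 ^ 3) (fun w => w 0 ^ 2) (fun _ => 0)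
    (fun w => (1 / 16 : ℝ) * w 0 ^ 3) 0 ?_ 1 hdot (γ₀ := 2) (M := 1 / 100) (d := 1) le_rfl (by norm_num)
    ?_ 0 (fun _ => rfl) (fun u => (1 / 16 : ℂ) * u 0 ^ 3) (r := 1) (S := 1 / 2) one_pos ?_ ?_ ?_ ?_
  · intro v _; ring
  · -- (1.9) at γ₀ = 2, d = 1, M = 1/100, with equality: Σ_b v_b² ≤ v₀²
    intro v
    unfold Ineq19
    simp only [Fin.sum_univ_one, Nat.cast_one]
    norm_num
  · -- `Vt = Re Φ∘ι`
    intro x _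
    simp only [← Complex.ofReal_pow, ← Complex.ofReal_ofNat, ← Complex.ofReal_one, ← Complex.ofReal_div,
      ← Complex.ofReal_mul, Complex.ofReal_re]
  · -- `Φ` entire
    intro x _
    exact ((differentiable_const _).mul ((differentiable_apply (0 : Fin 1)).pow 3)).differentiableOn
  · -- the value row `‖Φ u‖ ≤ ½` on the 1-ball about a real point of K (`|u₀| < 2`)
    intro x hx u hu
    rw [mem_closedBall, dist_zero_right] at hx; rw [mem_ball, dist_eq_norm] at hu
    have hx0 : |x 0| ≤ 1 := (norm_le_pi_norm x 0).trans hx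
    have hu0 : ‖u 0 - (x 0 : ℂ)‖ < 1 := lt_of_le_of_lt (norm_le_pi_norm (u - fun i => (x i : ℂ)) 0) hu
    have hu2 : ‖u 0‖ ≤ 2 := by
      have : ‖u 0‖ ≤ ‖u 0 - (x 0 : ℂ)‖ + ‖(x 0 : ℂ)‖ := norm_le_norm_sub_add _ _
      rw [Complex.norm_real, Real.norm_eq_abs] at this
      linarith
    have h1 : ‖(1 / 16 : ℂ)‖ = 1 / 16 := by
      rw [show (1 / 16 : ℂ) = ((1 / 16 : ℝ) : ℂ) by push_cast; ring, Complex.norm_real, Real.norm_eq_abs,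
        abs_of_pos (by norm_num)]
    calc ‖(1 / 16 : ℂ) * u 0 ^ 3‖ = 1 / 16 * ‖u 0‖ ^ 3 := by rw [norm_mul, norm_pow, h1]
      _ ≤ 1 / 16 * 2 ^ 3 := by gcongr
      _ = 1 / 2 := by norm_num
  · norm_num  -- the clause 4·1·1²·½ ≤ 2·1², with equality

/-- **WITNESS, negative half**: on the same instance g3's ★★′ (p607734 `convexOn_expansion_of_analyticSupBound`) is VOID
AT EVERY RADIUS — its `hdiam` forces `r > 2` (the points `±1`), its value row at the real point `1` and the complex point
`u₀ = r` forces `S ≥ r³∕16`, and then its clause `16·d·(100M)^{d+1}·S ≤ γ₀·r²` (`= 16·S ≤ 2r²`) fails; in particular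
`hdiam` itself fails at the radius `r = 1` used above.  So the diameter binder restricted the DEVICE (one Schwarz disc
holding both endpoints), not the truth of the conclusion. [textbook] -/
theorem diamClause_void_on_witness (r S : ℝ)
    (hdiam : ∀ x ∈ closedBall (0 : Fin 1 → ℝ) 1, ∀ y ∈ closedBall (0 : Fin 1 → ℝ) 1, ‖y - x‖ < r)
    (hΦS : ∀ x ∈ closedBall (0 : Fin 1 → ℝ) 1, ∀ u ∈ ball (fun i => (x i : ℂ)) r,
      ‖(1 / 16 : ℂ) * u 0 ^ 3‖ ≤ S) :
    ¬ (16 * (1 : ℕ) * (100 * (1 / 100 : ℝ)) ^ (1 + 1) * S ≤ 2 * r ^ 2) := by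
  -- `r > 2` from the points `±1`
  have hone : (fun _ : Fin 1 => (1 : ℝ)) ∈ closedBall (0 : Fin 1 → ℝ) 1 := by
    rw [mem_closedBall, dist_zero_right]; exact (pi_norm_le_iff_of_nonneg zero_le_one).2 fun _ => by simp
  have hneg : (fun _ : Fin 1 => (-1 : ℝ)) ∈ closedBall (0 : Fin 1 → ℝ) 1 := by
    rw [mem_closedBall, dist_zero_right]; exact (pi_norm_le_iff_of_nonneg zero_le_one).2 fun _ => by simp
  have hr2 : 2 < r := by
    have h := hdiam _ hneg _ hone
    have : ‖(fun _ : Fin 1 => (1 : ℝ)) - fun _ : Fin 1 => (-1 : ℝ)‖ = 2 := by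
      rw [show ((fun _ : Fin 1 => (1 : ℝ)) - fun _ : Fin 1 => (-1 : ℝ)) = fun _ => (2 : ℝ) by funext i; simp; norm_num]
      rw [pi_norm_const]; norm_num
    rwa [this] at h
  -- `S ≥ r³/16` from the real point `1` and the complex point `u₀ = r`
  have hu : (fun _ : Fin 1 => ((r : ℝ) : ℂ)) ∈ ball (fun i : Fin 1 => (((fun _ : Fin 1 => (1 : ℝ)) i : ℝ) : ℂ)) r := by
    rw [mem_ball, dist_eq_norm]
    have : ((fun _ : Fin 1 => ((r : ℝ) : ℂ)) - fun i : Fin 1 => (((fun _ : Fin 1 => (1 : ℝ)) i : ℝ) : ℂ))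
        = fun _ => (((r - 1 : ℝ)) : ℂ) := by funext i; simp only [Pi.sub_apply]; push_cast; ring
    rw [this, pi_norm_const, Complex.norm_real, Real.norm_eq_abs, abs_of_pos (by linarith)]
    linarith
  have hS := hΦS _ hone _ hu
  have hval : ‖(1 / 16 : ℂ) * ((r : ℝ) : ℂ) ^ 3‖ = r ^ 3 / 16 := by
    rw [show (1 / 16 : ℂ) * ((r : ℝ) : ℂ) ^ 3 = (((r ^ 3 / 16 : ℝ)) : ℂ) by push_cast; ring, Complex.norm_real,
      Real.norm_eq_abs, abs_of_pos (by positivity)]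
  simp only [hval] at hS
  -- the clause would give `r³ ≤ 2r²`, i.e. `r ≤ 2`
  intro hcl
  norm_num at hcl
  have hp : 0 < r ^ 2 * (r - 2) := mul_pos (by positivity) (by linarith)
  nlinarith [hS, hcl, hp]

end Witness

end Summit.QuantumFields.YangMills.Theorems.N21ChartExponentConvexityLocalSUN

end
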